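import Summits.Ventures.CertifiedManyBodySolver.Certificates.HubbardSquare_n7o8_upper_dbt299pair_row354
import Summits.Ventures.CertifiedManyBodySolver.Certificates.HubbardSquare_n7o8_upper_dbt329pair_row445
import Literature.MathematicalPhysics.QuantumLattice.HubbardTTPrimeCapCutDualRows
import Literature.MathematicalPhysics.QuantumLattice.HubbardFermiSeaCellRows
import Literature.MathematicalPhysics.QuantumLattice.HubbardTTPrimeBoxTransport
import Literature.MathematicalPhysics.QuantumLattice.HubbardNNNHoppingEnergyDensityRegionBounds
import HarnessLib

/-!
# Ventures/CertifiedManyBodySolver — Observables/MeanFieldClassExclusionStrip.lean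

HONEST FRAMING: first certified bounds; not a superconductivity verdict; every number certified or labelled float.
A competing-order EXCLUSION removes a named class of candidate ground states; it never says which order is present
(`OrderParameterInvisibleToGroundStateConstraints`); no phase sentence follows.

Cell `hubbard-tc` (MO-S3 ORDER → T_c back-end, D-0096), seat `hubbard-tc-mod-3` (G3: competing orders as exclusion inputs
from certified energy ORDERINGS), `prover-hubbard-tc-mod-3-g2-0`. KERNEL form of the cell's headline G3 annex word
(HOME `ASSUMPTIONS.md` §3 X1a, `EXCLUSION-TABLE.md` §B/§B″): on the whole cuprate `t′`-STRIP

  `t = 1`, `n = 7/8`, `t′ ∈ [−3/10, 0]`, `U ≥ 6`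

(which contains the `(U, t′)`-projection of the S1 boxes of record of La₂₋ₓSrₓCuO₄ at x = ⅛ — `U/t ∈ [7, 12.6]`,
`t′/t ∈ [−0.18, −0.08]` — of HgBa₂CuO₄₊δ for `U/t ≥ 6` and of NdNiO₂ — START-HERE v0.5 l.39), EVERY torus-limit ground state
`ω` (torus limits of unit `(rectN (7/8) L, S^z = 0)`-sector ground states of `hubbardTorusTT' L 1 t′ U`) has

  `Re ω(n_{0↑} n_{0↓}) < (7/16)² = (n/2)²`      (`m3Strip_docc_lt_sq_half_density_of`),

i.e. NO such ground state is a non-magnetic quasi-free (Hartree–Fock / BCS) state: for those, Wick's rule gives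
`ω(n_{x↑}n_{x↓}) = ω(n_{x↑})ω(n_{x↓}) + |ω(c_{x↓}c_{x↑})|² − |ω(c†_{x↑}c_{x↓})|² ≥ (n/2)²` when `ω(S_x^±) = 0` and `n_{x↑} = n_{x↓} = n/2`
(Bach–Lieb–Solovej 1994 §2; the class contains the paramagnetic and CDW Slater determinants and every singlet-paired BCS/HFB
state — s, d_{x²−y²}, extended-s, pair-density-wave — with any gap; the identification «quasi-free ⇒ docc ≥ (n/2)²» is the
docstring's reading, the THEOREM is the strict docc inequality). The tree already knows the NON-strict kinematic form
`docc ≤ (n/2)²` at every `U > 0` (`IsTorusLimitOf.re_expect_docc_le_sq_half_density_of_groundState`); what is certified here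
is the STRICT inequality with a quantitative gap, from two certified energy ceilings.

Proof = three tree devices, no new mathematics: (1) the CAPS `e(1, 0, 8, 7/8) ≤ u₃₅₄` (CERTIFIED #354, claim node
`cert_dbt299pair_allk`) and `e(1, −1/4, 8, 7/8) ≤ u₄₄₅` (CERTIFIED #445, `cert_dbt329pair_allk`) transported over the strip by the
decimal kinematic `t′`-law `|Δe| ≤ 1.6212·|Δt′|` (`energyDensityTT'_tPrime_transport_ge_decimal`, `1.6212 > 16/π²`), by
monotonicity in `U` below `U = 8` (`energyDensityTT'_mono_U`) and by the Hartree–Fock Lipschitz constant `(n/2)² = 49/256` above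
(`energyDensityTT'_ge_sub_mul_sq_U`) — `strip78_cap_of_anchor`; (2) the kernel cell-exact FERMI-SEA floors of the free gas at
`n = 7/8`, `t′ ∈ {−3/10, −1/4, −1/5, −1/10, 0}` (`fermiSeaCellRow_tPrime_*_density_seven_div_eight`) read between consecutive
columns by concavity in `t′` (`energyDensityTT'_tPrime_interval_ge_kinematic`, zero transport loss inside) — `strip78_floor_between`;
(3) the `U`-chord for the double occupancy between the cut `U₀ = 0` and the cap at `U`
(`IsTorusLimitOf.re_expect_docc_le_chord_of_groundState`: `docc ≤ (u − ℓ)/U`). The margin `ℓ_free + U·49/256 − u_cap` is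
`≥ +0.057` at the worst point (`t′ ≈ −0.13`, `U = 6`) and `≥ +0.44` for `U ≥ 8` (exact decimal arithmetic, `linarith`).
Also recorded: the uniform docc CEILING `Re ω(n_{0↑}n_{0↓}) ≤ 0.137` at `U = 8` on the whole strip (`m3Strip_docc_le_decimal_U8_of`)
— the only certified docc ceiling at interior `t′` (the SDP rows #261 / #257 give 0.0989 / 0.0945 at `t′ = 0` / `−1/4` only).

Strength: conditional on the two claim nodes BY HYPOTHESIS (retracted with either); everything else is a proved tree theorem.
WHAT THIS IS NOT: a bound at a new anchor; a statement about stripes, d-wave order or T_c; tight.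

References: T. Koma, H. Tasaki, J. Stat. Phys. 76 (1994) 745, §1 (supergradient / `U`-chord) [KomaTasaki1994];
V. Bach, E. H. Lieb, J. P. Solovej, J. Stat. Phys. 76 (1994) 3, §2 eq. (2c.36) (quasi-free states, the HF functional)
[BachLiebSolovej1994]; E. H. Lieb, M. Loss, Duke Math. J. 71 (1993) 337, §8 Thm 8.2 (bathtub / Fermi sea) [LiebLoss1993];
R. B. Israel, Convexity in the Theory of Lattice Gases (1979), Thm I.3.4 (Lipschitz in the interaction) [Israel1979].
-/

noncomputable section

namespace Summit.Ventures.CertifiedManyBodySolver.Observables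

open Literature.MathematicalPhysics.QuantumLattice
open Literature.MathematicalPhysics.QuantumLattice.ThermodynamicLimit
open Summit.Ventures.CertifiedManyBodySolver.Certificates
open Matrix HubbardWave0 Literature.Probability.LatticeModels Filter Topology
open scoped ComplexOrder BigOperators

/-! ### §1 The transported energy CAP on the strip `n = 7/8` -/

/-- **Cap transport from one anchor column** (`n = 7/8`): a certified ceiling `e(1, s₀, 8, 7/8) ≤ R` gives, at every
`s` and every `U ≥ 0`, `e(1, s, U, 7/8) ≤ R + 1.6212·|s − s₀| + (49/256)·max(U − 8, 0)` — the decimal kinematic `t′`-law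
at `U = 8`, then monotonicity in `U` (below 8) or the Hartree–Fock Lipschitz constant `(n/2)² = 49/256` (above 8).
[cite: Israel1979, Thm. I.3.4] [cite: KomaTasaki1994, §1] -/
theorem strip78_cap_of_anchor {s₀ R : ℝ} (hR : energyDensityTT' 1 s₀ 8 (7 / 8) ≤ R) (s : ℝ) {U : ℝ}
    (hU : 0 ≤ U) :
    energyDensityTT' 1 s U (7 / 8) ≤ R + 1.6212 * |s - s₀| + 49 / 256 * max (U - 8) 0 := by
  have hn0 : (0 : ℝ) ≤ 7 / 8 := by norm_num
  have hn2 : (7 / 8 : ℝ) < 2 := by norm_num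
  have h8 : energyDensityTT' 1 s 8 (7 / 8) ≤ R + 1.6212 * |s - s₀| := by
    have h := energyDensityTT'_tPrime_transport_ge_decimal 1 (by norm_num : (0 : ℝ) ≤ 8) hn0 hn2 s s₀
    rw [abs_sub_comm] at h
    linarith
  rcases le_total U 8 with hle | hle
  · have hm := energyDensityTT'_mono_U 1 s hn0 hn2 hU hle
    have h0 : (0 : ℝ) ≤ 49 / 256 * max (U - 8) 0 := by positivity
    linarith
  · have hq := energyDensityTT'_ge_sub_mul_sq_U 1 s hn0 hn2 (by norm_num : (0 : ℝ) ≤ 8) hle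
    rw [max_eq_left (by linarith : (0 : ℝ) ≤ U - 8)]
    norm_num at hq
    linarith

/-- The CERTIFIED #354 cap as a decimal: `e(1, 0, 8, 7/8) ≤ −0.7059400775` (claim node `cert_dbt299pair_allk`,
`M3EnergyUpperRow 0 (−99352233445291/2⁴⁷)` via `m3_tp0_upper_dbt299pair_allk_of`; outward rounding). [cite: Ruelle1969, §3.3] -/
theorem m3_tp0_cap_decimal_of (h354 : cert_dbt299pair_allk) :
    energyDensityTT' 1 0 8 (7 / 8) ≤ -0.7059400775 := by
  have h := m3_tp0_upper_dbt299pair_allk_of h354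
  unfold M3EnergyUpperRow at h
  refine h.trans ?_
  push_cast
  norm_num

/-- The CERTIFIED #445 cap as a decimal: `e(1, −1/4, 8, 7/8) ≤ −0.6866417849` (claim node `cert_dbt329pair_allk`,
`M3EnergyUpperRow (−1/4) (−12079530027017/2⁴⁴)` via `m3_tpm1o4_upper_dbt329pair_allk_of`; outward rounding). [cite: Ruelle1969, §3.3] -/
theorem m3_tpm1o4_cap_decimal_of (h445 : cert_dbt329pair_allk) :
    energyDensityTT' 1 (-1 / 4) 8 (7 / 8) ≤ -0.6866417849 := by
  have h := m3_tpm1o4_upper_dbt329pair_allk_of h445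
  unfold M3EnergyUpperRow at h
  refine h.trans ?_
  push_cast
  norm_num

/-! ### §2 The free-gas FLOOR on the strip (kernel Fermi-sea rows read between columns by concavity) -/

/-- **Floor between two floored columns** (`n = 7/8`): floors `La ≤ e(1, a, U, 7/8)`, `Lb ≤ e(1, b, U, 7/8)` at
`a ≤ b` give `min La Lb ≤ e(1, s, U, 7/8)` for every `s ∈ [a, b]` — concavity of `t′ ↦ e` (the interval lemma
`energyDensityTT'_tPrime_interval_ge_kinematic` with zero outward margins). [cite: Israel1979, Thm. I.3.4] -/
theorem strip78_floor_between {a b La Lb s U : ℝ} (hU : 0 ≤ U) (hab : a ≤ b)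
    (hLa : La ≤ energyDensityTT' 1 a U (7 / 8)) (hLb : Lb ≤ energyDensityTT' 1 b U (7 / 8))
    (has : a ≤ s) (hsb : s ≤ b) :
    min La Lb ≤ energyDensityTT' 1 s U (7 / 8) := by
  have h := energyDensityTT'_tPrime_interval_ge_kinematic 1 hU (by norm_num : (0 : ℝ) ≤ 7 / 8)
    (by norm_num : (7 / 8 : ℝ) < 2) hab hLa hLb has hsb
  simpa only [sub_self, max_self, mul_zero, sub_zero] using h

/-- **The free Fermi sea floors the strip**: for `t′ ∈ [−3/10, 0]` and every `U ≥ 0`,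
`−1.6103642235 ≤ e(1, t′, U, 7/8)` — the smallest of the five kernel cell-exact Fermi-sea rows at `n = 7/8`
(`t′ = 0` column), valid between the columns by concavity. (Coarse uniform form; the proof of the main theorem uses the
sharper piecewise floors.) [cite: LiebLoss1993, §8, Theorem 8.2] -/
theorem strip78_floor_uniform {t' U : ℝ} (hU : 0 ≤ U) (ht1 : -3 / 10 ≤ t') (ht0 : t' ≤ 0) :
    (-1.6103642235 : ℝ) ≤ energyDensityTT' 1 t' U (7 / 8) := by
  have r30 := fermiSeaCellRow_tPrime_neg_three_div_ten_density_seven_div_eight hU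
  have r0 := fermiSeaCellRow_tPrime_zero_density_seven_div_eight hU
  have h := strip78_floor_between hU (by norm_num : (-3 / 10 : ℝ) ≤ 0) r30 r0 ht1 ht0
  exact le_trans (le_min (by norm_num) le_rfl) h

/-! ### §3 The class exclusion: `docc < (n/2)²` for every torus-limit ground state on the strip -/

/-- **The arithmetic tail, strict form.** A cap `e(1, t′, U, 7/8) ≤ u` (`U > 0`), a free floor `ℓ ≤ e(1, t′, 0, 7/8)` and the
linear margin `u − ℓ < (49/256)·U` give `Re ω(n_{0↑}n_{0↓}) < 49/256` for every torus-limit ground state `ω` at `(1, t′, U, 7/8)`: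
the docc `U`-chord between the cut `U₀ = 0` and the cap (`IsTorusLimitOf.re_expect_docc_le_chord_of_groundState`).
[cite: KomaTasaki1994, §1] -/
theorem docc78_lt_of_cap_of_floor {t' U u ℓ : ℝ} (hU : 0 < U)
    (hcap : energyDensityTT' 1 t' U (7 / 8) ≤ u) (hℓ : ℓ ≤ energyDensityTT' 1 t' 0 (7 / 8))
    (hlin : u - ℓ < 49 / 256 * U) :
    ∀ (ω : InfVolFermionState 2) (Ls : ℕ → ℕ) (ψ : ∀ L, Fock (Orb (FermionTorus 2 L))),
      Tendsto Ls atTop atTop →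
      (∀ j, IsGroundStateInSector (hubbardTorusTT' (Ls j) 1 t' U) (rectN (7 / 8) (Ls j)) 0 (ψ (Ls j))) →
      (∀ j, star (ψ (Ls j)) ⬝ᵥ ψ (Ls j) = 1) → ω.IsTorusLimitOf ψ Ls →
      (ω.expect ({0} : Finset (Site 2))
        (nAt 0 (Finset.mem_singleton_self 0) 0 * nAt 0 (Finset.mem_singleton_self 0) 1)).re < 49 / 256 := by
  intro ω Ls ψ hLs hψ h1 hω
  have hd := hω.re_expect_docc_le_chord_of_groundState 1 t' hU.le (by norm_num : (0 : ℝ) ≤ 7 / 8)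
    (by norm_num : (7 / 8 : ℝ) < 2) hLs hψ h1 hcap le_rfl hU hℓ
  rw [sub_zero] at hd
  exact lt_of_le_of_lt hd ((div_lt_iff₀ hU).2 hlin)

/-- **The arithmetic tail, non-strict form**: cap, free floor and `u − ℓ ≤ c·U` give `Re ω(n_{0↑}n_{0↓}) ≤ c`.
[cite: KomaTasaki1994, §1] -/
theorem docc78_le_of_cap_of_floor {t' U u ℓ c : ℝ} (hU : 0 < U)
    (hcap : energyDensityTT' 1 t' U (7 / 8) ≤ u) (hℓ : ℓ ≤ energyDensityTT' 1 t' 0 (7 / 8))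
    (hlin : u - ℓ ≤ c * U) :
    ∀ (ω : InfVolFermionState 2) (Ls : ℕ → ℕ) (ψ : ∀ L, Fock (Orb (FermionTorus 2 L))),
      Tendsto Ls atTop atTop →
      (∀ j, IsGroundStateInSector (hubbardTorusTT' (Ls j) 1 t' U) (rectN (7 / 8) (Ls j)) 0 (ψ (Ls j))) →
      (∀ j, star (ψ (Ls j)) ⬝ᵥ ψ (Ls j) = 1) → ω.IsTorusLimitOf ψ Ls →
      (ω.expect ({0} : Finset (Site 2))
        (nAt 0 (Finset.mem_singleton_self 0) 0 * nAt 0 (Finset.mem_singleton_self 0) 1)).re ≤ c := by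
  intro ω Ls ψ hLs hψ h1 hω
  have hd := hω.re_expect_docc_le_chord_of_groundState 1 t' hU.le (by norm_num : (0 : ℝ) ≤ 7 / 8)
    (by norm_num : (7 / 8 : ℝ) < 2) hLs hψ h1 hcap le_rfl hU hℓ
  rw [sub_zero] at hd
  exact hd.trans ((div_le_iff₀ hU).2 hlin)

/-- **MEAN-FIELD / BCS CLASS EXCLUSION ON THE CUPRATE STRIP (kernel G3 word).** Assume the claim nodes of CERTIFIED #354
(`cert_dbt299pair_allk`) and #445 (`cert_dbt329pair_allk`). Then for every `t′ ∈ [−3/10, 0]`, every `U ≥ 6`, and every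
torus limit `ω` of unit `(rectN (7/8) L, S^z = 0)`-sector ground states of `hubbardTorusTT' L 1 t′ U` along `L → ∞`:
`Re ω(n_{0↑} n_{0↓}) < (7/16)²` — the ground-state double occupancy lies STRICTLY below the uncorrelated value `(n/2)²`, so
no such ground state is a non-magnetic quasi-free (Hartree–Fock / singlet BCS, any gap, uniform d-wave included) state.
Proof: cap (§1) from the nearer anchor column, piecewise Fermi-sea floor (§2) at `U₀ = 0`, and the docc `U`-chord
`docc ≤ (u − ℓ)/U`; the five linear margins are `≥ 0.057` (`U = 6`) and `≥ 0.44` (`U ≥ 8`).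
[cite: KomaTasaki1994, §1] [cite: BachLiebSolovej1994, eq. (2c.36)] [cite: LiebLoss1993, §8, Theorem 8.2] -/
theorem m3Strip_docc_lt_sq_half_density_of (h354 : cert_dbt299pair_allk) (h445 : cert_dbt329pair_allk)
    {t' U : ℝ} (ht1 : -3 / 10 ≤ t') (ht0 : t' ≤ 0) (hU6 : 6 ≤ U) :
    ∀ (ω : InfVolFermionState 2) (Ls : ℕ → ℕ) (ψ : ∀ L, Fock (Orb (FermionTorus 2 L))),
      Tendsto Ls atTop atTop →
      (∀ j, IsGroundStateInSector (hubbardTorusTT' (Ls j) 1 t' U) (rectN (7 / 8) (Ls j)) 0 (ψ (Ls j))) →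
      (∀ j, star (ψ (Ls j)) ⬝ᵥ ψ (Ls j) = 1) → ω.IsTorusLimitOf ψ Ls →
      (ω.expect ({0} : Finset (Site 2))
        (nAt 0 (Finset.mem_singleton_self 0) 0 * nAt 0 (Finset.mem_singleton_self 0) 1)).re < (7 / 16) ^ 2 := by
  intro ω Ls ψ hLs hψ h1 hω
  rw [show ((7 : ℝ) / 16) ^ 2 = 49 / 256 by norm_num]
  have hU0 : (0 : ℝ) < U := by linarith
  -- the two transported caps at (t', U)
  have hcapA := strip78_cap_of_anchor (m3_tp0_cap_decimal_of h354) t' hU0.le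
  have hcapB := strip78_cap_of_anchor (m3_tpm1o4_cap_decimal_of h445) t' hU0.le
  rw [sub_zero, abs_of_nonpos ht0] at hcapA
  rw [show t' - -1 / 4 = t' + 1 / 4 by ring] at hcapB
  -- the five kernel Fermi-sea columns at U₀ = 0
  have r30 := fermiSeaCellRow_tPrime_neg_three_div_ten_density_seven_div_eight (U := 0) le_rfl
  have r25 := fermiSeaCellRow_tPrime_neg_one_div_four_density_seven_div_eight (U := 0) le_rfl
  have r20 := fermiSeaCellRow_tPrime_neg_one_div_five_density_seven_div_eight (U := 0) le_rfl
  have r10 := fermiSeaCellRow_tPrime_neg_one_div_ten_density_seven_div_eight (U := 0) le_rfl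
  have r00 := fermiSeaCellRow_tPrime_zero_density_seven_div_eight (U := 0) le_rfl
  -- the `max (U - 8) 0` term: two linear regimes
  have hmax : 49 / 256 * max (U - 8) 0 = 49 / 256 * U - 49 / 32 ∨
      (49 / 256 * max (U - 8) 0 = 0 ∧ U ≤ 8) := by
    rcases le_total U 8 with hle | hle
    · right; exact ⟨by rw [max_eq_right (by linarith : U - 8 ≤ 0), mul_zero], hle⟩
    · left; rw [max_eq_left (by linarith : (0 : ℝ) ≤ U - 8)]; ring
  -- piecewise in t'
  rcases le_or_gt t' (-1 / 4) with hA | hA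
  · -- piece [-3/10, -1/4]: anchor -1/4 (query to its left), floor min(r30, r25)
    have hfl := strip78_floor_between (s := t') le_rfl (by norm_num : (-3 / 10 : ℝ) ≤ -1 / 4) r30 r25 ht1 hA
    have hℓ : (-1.5633688449 : ℝ) ≤ energyDensityTT' 1 t' 0 (7 / 8) :=
      le_trans (le_min (by norm_num) le_rfl) hfl
    rw [abs_of_nonpos (by linarith : t' + 1 / 4 ≤ 0)] at hcapB
    exact docc78_lt_of_cap_of_floor hU0 hcapB hℓ (by rcases hmax with h | ⟨h, h8⟩ <;> linarith)
      ω Ls ψ hLs hψ h1 hω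
  rw [abs_of_nonneg (by linarith : 0 ≤ t' + 1 / 4)] at hcapB
  rcases le_or_gt t' (-1 / 5) with hB | hB
  · -- piece (-1/4, -1/5]: anchor -1/4, floor min(r25, r20)
    have hfl := strip78_floor_between (s := t') le_rfl (by norm_num : (-1 / 4 : ℝ) ≤ -1 / 5) r25 r20 hA.le hB
    have hℓ : (-1.5668014377 : ℝ) ≤ energyDensityTT' 1 t' 0 (7 / 8) :=
      le_trans (le_min (by norm_num) le_rfl) hfl
    exact docc78_lt_of_cap_of_floor hU0 hcapB hℓ (by rcases hmax with h | ⟨h, h8⟩ <;> linarith)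
      ω Ls ψ hLs hψ h1 hω
  rcases le_or_gt t' (-13 / 100) with hC | hC
  · -- piece (-1/5, -13/100]: anchor -1/4, floor min(r20, r10)
    have hfl := strip78_floor_between (s := t') le_rfl (by norm_num : (-1 / 5 : ℝ) ≤ -1 / 10) r20 r10 hB.le
      (by linarith)
    have hℓ : (-1.5831346202 : ℝ) ≤ energyDensityTT' 1 t' 0 (7 / 8) :=
      le_trans (le_min (by norm_num) le_rfl) hfl
    exact docc78_lt_of_cap_of_floor hU0 hcapB hℓ (by rcases hmax with h | ⟨h, h8⟩ <;> linarith)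
      ω Ls ψ hLs hψ h1 hω
  rcases le_or_gt t' (-1 / 10) with hD | hD
  · -- piece (-13/100, -1/10]: anchor 0, floor min(r20, r10)
    have hfl := strip78_floor_between (s := t') le_rfl (by norm_num : (-1 / 5 : ℝ) ≤ -1 / 10) r20 r10 hB.le hD
    have hℓ : (-1.5831346202 : ℝ) ≤ energyDensityTT' 1 t' 0 (7 / 8) :=
      le_trans (le_min (by norm_num) le_rfl) hfl
    exact docc78_lt_of_cap_of_floor hU0 hcapA hℓ (by rcases hmax with h | ⟨h, h8⟩ <;> linarith)
      ω Ls ψ hLs hψ h1 hω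
  · -- piece (-1/10, 0]: anchor 0, floor min(r10, r00)
    have hfl := strip78_floor_between (s := t') le_rfl (by norm_num : (-1 / 10 : ℝ) ≤ 0) r10 r00 hD.le ht0
    have hℓ : (-1.6103642235 : ℝ) ≤ energyDensityTT' 1 t' 0 (7 / 8) :=
      le_trans (le_min (by norm_num) le_rfl) hfl
    exact docc78_lt_of_cap_of_floor hU0 hcapA hℓ (by rcases hmax with h | ⟨h, h8⟩ <;> linarith)
      ω Ls ψ hLs hψ h1 hω

/-- **Uniform docc CEILING on the strip at `U = 8`**: under the same two claim nodes, for every `t′ ∈ [−3/10, 0]` and every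
torus limit `ω` of unit `(rectN (7/8) L, S^z = 0)`-sector ground states of `hubbardTorusTT' L 1 t′ 8`:
`Re ω(n_{0↑} n_{0↓}) ≤ 0.137` (the maximum over the strip of `(u_cap − ℓ_free)/8`, attained near `t′ = −0.13`; at the two
anchors the SDP rows #261 / #257 are sharper: 0.0989 / 0.0945). The only certified docc ceiling at interior `t′` today.
[cite: KomaTasaki1994, §1] [cite: LiebLoss1993, §8, Theorem 8.2] -/
theorem m3Strip_docc_le_decimal_U8_of (h354 : cert_dbt299pair_allk) (h445 : cert_dbt329pair_allk)
    {t' : ℝ} (ht1 : -3 / 10 ≤ t') (ht0 : t' ≤ 0) :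
    ∀ (ω : InfVolFermionState 2) (Ls : ℕ → ℕ) (ψ : ∀ L, Fock (Orb (FermionTorus 2 L))),
      Tendsto Ls atTop atTop →
      (∀ j, IsGroundStateInSector (hubbardTorusTT' (Ls j) 1 t' 8) (rectN (7 / 8) (Ls j)) 0 (ψ (Ls j))) →
      (∀ j, star (ψ (Ls j)) ⬝ᵥ ψ (Ls j) = 1) → ω.IsTorusLimitOf ψ Ls →
      (ω.expect ({0} : Finset (Site 2))
        (nAt 0 (Finset.mem_singleton_self 0) 0 * nAt 0 (Finset.mem_singleton_self 0) 1)).re ≤ 0.137 := by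
  intro ω Ls ψ hLs hψ h1 hω
  have h8 : (0 : ℝ) < 8 := by norm_num
  have hcapA := strip78_cap_of_anchor (m3_tp0_cap_decimal_of h354) t' h8.le
  have hcapB := strip78_cap_of_anchor (m3_tpm1o4_cap_decimal_of h445) t' h8.le
  rw [sub_zero, abs_of_nonpos ht0, sub_self, max_self, mul_zero, add_zero] at hcapA
  rw [show t' - -1 / 4 = t' + 1 / 4 by ring, sub_self, max_self, mul_zero, add_zero] at hcapB
  have r30 := fermiSeaCellRow_tPrime_neg_three_div_ten_density_seven_div_eight (U := 0) le_rfl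
  have r25 := fermiSeaCellRow_tPrime_neg_one_div_four_density_seven_div_eight (U := 0) le_rfl
  have r20 := fermiSeaCellRow_tPrime_neg_one_div_five_density_seven_div_eight (U := 0) le_rfl
  have r10 := fermiSeaCellRow_tPrime_neg_one_div_ten_density_seven_div_eight (U := 0) le_rfl
  have r00 := fermiSeaCellRow_tPrime_zero_density_seven_div_eight (U := 0) le_rfl
  rcases le_or_gt t' (-1 / 4) with hA | hA
  · have hfl := strip78_floor_between (s := t') le_rfl (by norm_num : (-3 / 10 : ℝ) ≤ -1 / 4) r30 r25 ht1 hA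
    have hℓ : (-1.5633688449 : ℝ) ≤ energyDensityTT' 1 t' 0 (7 / 8) :=
      le_trans (le_min (by norm_num) le_rfl) hfl
    rw [abs_of_nonpos (by linarith : t' + 1 / 4 ≤ 0)] at hcapB
    exact docc78_le_of_cap_of_floor h8 hcapB hℓ (by linarith) ω Ls ψ hLs hψ h1 hω
  rw [abs_of_nonneg (by linarith : 0 ≤ t' + 1 / 4)] at hcapB
  rcases le_or_gt t' (-1 / 5) with hB | hB
  · have hfl := strip78_floor_between (s := t') le_rfl (by norm_num : (-1 / 4 : ℝ) ≤ -1 / 5) r25 r20 hA.le hB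
    have hℓ : (-1.5668014377 : ℝ) ≤ energyDensityTT' 1 t' 0 (7 / 8) :=
      le_trans (le_min (by norm_num) le_rfl) hfl
    exact docc78_le_of_cap_of_floor h8 hcapB hℓ (by linarith) ω Ls ψ hLs hψ h1 hω
  rcases le_or_gt t' (-13 / 100) with hC | hC
  · have hfl := strip78_floor_between (s := t') le_rfl (by norm_num : (-1 / 5 : ℝ) ≤ -1 / 10) r20 r10 hB.le
      (by linarith)
    have hℓ : (-1.5831346202 : ℝ) ≤ energyDensityTT' 1 t' 0 (7 / 8) :=
      le_trans (le_min (by norm_num) le_rfl) hfl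
    exact docc78_le_of_cap_of_floor h8 hcapB hℓ (by linarith) ω Ls ψ hLs hψ h1 hω
  rcases le_or_gt t' (-1 / 10) with hD | hD
  · have hfl := strip78_floor_between (s := t') le_rfl (by norm_num : (-1 / 5 : ℝ) ≤ -1 / 10) r20 r10 hB.le hD
    have hℓ : (-1.5831346202 : ℝ) ≤ energyDensityTT' 1 t' 0 (7 / 8) :=
      le_trans (le_min (by norm_num) le_rfl) hfl
    exact docc78_le_of_cap_of_floor h8 hcapA hℓ (by linarith) ω Ls ψ hLs hψ h1 hω
  · have hfl := strip78_floor_between (s := t') le_rfl (by norm_num : (-1 / 10 : ℝ) ≤ 0) r10 r00 hD.le ht0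
    have hℓ : (-1.6103642235 : ℝ) ≤ energyDensityTT' 1 t' 0 (7 / 8) :=
      le_trans (le_min (by norm_num) le_rfl) hfl
    exact docc78_le_of_cap_of_floor h8 hcapA hℓ (by linarith) ω Ls ψ hLs hψ h1 hω

end Summit.Ventures.CertifiedManyBodySolver.Observables

end
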